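import Summits.BirchSwinnertonDyer.BirchSwinnertonDyer.Theorems.ByReductionTypeAtTwoRankOnePerrinRiouConstantTermsAtTwo
import Literature.NumberTheory.EllipticCurves.LeadingTermPPartProofs
import Literature.NumberTheory.EllipticCurves.AnalyticRankOrderProofs
import Literature.NumberTheory.EllipticCurves.AnalyticRankModularityProofs
import HarnessLib

/-!
# Route `ByReductionTypeAtTwo`, crux `RankOneAtTwoBigImageOddLocal` (item stmt-BirchSwinnertonDyer-23715): THE ORDER OF VANISHING
# AT `T = 0` OF SPRUNG'S PAIR AT `p = 2` VERSUS `L(E,1)` — `L♭(0) = 0 ⟺ L(E,1) = 0 ⟺ L♯(0) = 0`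

HONEST FRAMING (cell `bsd-f1-sign2`, planner seat `-an` g51).  Everything here is PROVED (no `sorry`, no `def`, nothing booked; BSD is
not proved and 23715 is not closed).  These are the `T = 0` RECEPTACLES that the crux's leading-term statements (55A/55A′ of
`…PerrinRiouElementAtTwo.lean` / `…PerrinRiouConstantTermsAtTwo.lean`, which speak about the `T¹`-coefficients `c₁♯, c₁♭`) silently
presuppose: in analytic rank `≥ 1` BOTH `L♯` and `L♭` vanish at `T = 0`, so `c₁♯, c₁♭` are indeed the leading candidates; in analytic
rank `0` on the supersingular branch NEITHER vanishes.

CONTENT.  For `f` the newform of `W` (`IsNewformOf W f`), `W` with good reduction at `2`, `a₂ = W.frobeniusTrace 2`, and ANY Sprung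
pair `(L♯, L♭)` (`IsSprungPair f 2 a₂ L♯ L♭`):
* `ratPlusSymbol_zero_eq_zero_iff` : `[0]⁺_f = 0 ⟺ L(E,1) = 0` (`L(E,1) = [0]⁺_f·Ω⁺_f`, `Ω⁺_f > 0`; MTT §I.8 (8.6));
* `sharpPrefactorTwo_eq_zero_iff` : `A(a) = 0 ⟺ a = 1` (`A(a) = −(a−1)(a²−a−4)`, `17` is not a square) and
  `flatPrefactorTwo_ne_zero_of_even` : `B(a) ≠ 0` for even `a` (`B` odd);
* `constantCoeff_flat_eq_zero_iff`  (`a₂` even):  `L♭(0) = 0 ⟺ L(E,1) = 0`;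
* `constantCoeff_sharp_eq_zero_iff` (`a₂ ≠ 1`):   `L♯(0) = 0 ⟺ L(E,1) = 0`;
* `constantCoeff_eq_zero_of_analyticRank_ne_zero` : `r_an(E) ≠ 0 ⟹ L♯(0) = 0 ∧ L♭(0) = 0` (no hypothesis on `a₂`);
* `constantCoeff_ne_zero_of_analyticRank_eq_zero` : `r_an(E) = 0 ∧ a₂ even ⟹ L♯(0) ≠ 0 ∧ L♭(0) ≠ 0`
  (modularity ⇒ `L(E,s)` entire ⇒ `r_an = 0 ⟺ L(E,1) ≠ 0`, `analyticRank_eq_zero_iff_holds`).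
All from the constant terms `L♭(0) = B(a₂)[0]⁺_f`, `L♯(0) = A(a₂)[0]⁺_f` (`constantCoeff_flat_eq_two`, `constantCoeff_sharp_eq_two`).
This is the `p = 2`, `♯/♭` counterpart of the odd-`p` statement «`1 ≤ ord_T L_p^±` in positive analytic rank» (Pollack 2003
Thm. 5.1 at `n = 0`; Sprung arXiv:1512.09362, table of special values, `p = 2` row).  PARTITION: none moved (corollary-of-print at
route-item level; beyond-print theorem: no).  bears_on: stmt-BirchSwinnertonDyer-23715.
-/

noncomputable section

open scoped Classical MatrixGroups ModularForm

open CongruenceSubgroup PowerSeries WeierstrassCurve Literature.NumberTheory.EllipticCurves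
  Literature.NumberTheory.EllipticCurves.ModularForms Literature.NumberTheory.EllipticCurves.Sprung2017
  Literature.NumberTheory.EllipticCurves.Rank1Residual

namespace Summit.BirchSwinnertonDyer.BirchSwinnertonDyer.Theorems.PerrinRiouElementAtTwo

set_option linter.dupNamespace false

/-! ### §1 `[0]⁺_f = 0 ⟺ L(E,1) = 0`, and the zeros of the prefactors -/

section Prefactors

variable {N : ℕ} [NeZero N] {f : CuspForm (Gamma0 N) 2} {W : WeierstrassCurve ℚ} [W.IsElliptic]

/-- `[0]⁺_f = 0 ⟺ L(E,1) = 0` for the newform `f` of `W`: `L(E,1) = [0]⁺_f · Ω⁺_f` (`IsNewformOf.entireLFunction_one_eq`) with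
`Ω⁺_f > 0` (`IsNewform0.plusPeriod_pos_holds`). [cite: MazurTateTeitelbaum1986Invent, §I.8 (8.6)] -/
theorem ratPlusSymbol_zero_eq_zero_iff (hf : IsNewformOf W f) : ratPlusSymbol f 0 = 0 ↔ W.entireLFunction 1 = 0 := by
  have hpos : 0 < plusPeriod f := IsNewform0.plusPeriod_pos_holds hf.1 hf.coeffField_eq_bot
  have hval := hf.entireLFunction_one_eq
  constructor
  · intro h0
    rw [hval, h0]
    push_cast
    ring
  · intro hL
    rw [hL] at hval
    have hreal : ((ratPlusSymbol f 0 : ℚ) : ℝ) * plusPeriod f = 0 := by exact_mod_cast hval.symm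
    rcases mul_eq_zero.mp hreal with h | h
    · exact_mod_cast h
    · exact absurd h hpos.ne'

omit [NeZero N] [W.IsElliptic] in
/-- `A(a) = −a³+2a²+3a−4 = −(a−1)(a²−a−4)` vanishes at the integer `a` iff `a = 1` (`a²−a−4 = 0` would make `17 = (2a−1)²` a
square). [folklore] -/
theorem sharpPrefactorTwo_eq_zero_iff {a : ℤ} : sharpPrefactorTwo a = 0 ↔ a = 1 := by
  constructor
  · intro h
    by_contra ha
    have h1 : (a - 1) * (a ^ 2 - a - 4) = 0 := by unfold sharpPrefactorTwo at h; linear_combination -h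
    have h2 : a ^ 2 - a - 4 = 0 := (mul_eq_zero.mp h1).resolve_left (sub_ne_zero.mpr ha)
    have h3 : (2 * a - 1) ^ 2 = 17 := by linear_combination 4 * h2
    obtain ⟨m, hm⟩ : ∃ m : ℤ, m = 2 * a - 1 := ⟨_, rfl⟩
    rw [← hm] at h3
    have hb : m ≤ 4 ∧ -4 ≤ m := by constructor <;> nlinarith [h3]
    obtain ⟨hb1, hb2⟩ := hb
    interval_cases m <;> omega
  · rintro rfl
    rfl

omit [NeZero N] [W.IsElliptic] in
/-- `B(a) = −a²+2a+1 ≠ 0` for even `a` (`B(a)` is odd, `flatPrefactorTwo_odd_and_sharpPrefactorTwo_even`). [folklore] -/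
theorem flatPrefactorTwo_ne_zero_of_even {a : ℤ} (ha : Even a) : flatPrefactorTwo a ≠ 0 := by
  intro h
  have hodd := (flatPrefactorTwo_odd_and_sharpPrefactorTwo_even ha).1
  rw [h] at hodd
  exact (Int.not_odd_iff_even.mpr (by decide : Even (0 : ℤ))) hodd

end Prefactors

/-! ### §2 `L♭(0) = 0 ⟺ L(E,1) = 0 ⟺ L♯(0) = 0` and the analytic-rank readings -/

section Main

variable {N : ℕ} [NeZero N] {f : CuspForm (Gamma0 N) 2} {W : WeierstrassCurve ℚ} [W.IsElliptic] [W.IsGloballyMinimal]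
  {Lsharp Lflat : IwasawaAlgebra 2}

omit [NeZero N] [W.IsElliptic] [W.IsGloballyMinimal] in
/-- An element of `ℤ₂` whose image in `ℚ₂` is `c·t` (`c, t ∈ ℚ`, `c ≠ 0`) vanishes iff `t = 0`. [folklore] -/
private theorem padicInt_eq_zero_iff_of_coe_eq {x : ℤ_[2]} {c t : ℚ} (hc : c ≠ 0)
    (h : ((x : ℤ_[2]) : ℚ_[2]) = ((c * t : ℚ) : ℚ_[2])) : x = 0 ↔ t = 0 := by
  constructor
  · intro hx
    rw [hx, PadicInt.coe_zero] at h
    have : (c * t : ℚ) = 0 := by exact_mod_cast h.symm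
    exact (mul_eq_zero.mp this).resolve_left hc
  · intro ht
    rw [ht, mul_zero, Rat.cast_zero] at h
    exact PadicInt.ext (by simpa using h)

/-- **`L♭(0) = 0 ⟺ L(E,1) = 0`** at a good prime `2` with `a₂` even (in particular on the supersingular branch `GoodSS W 2`).
[cite: Sprung2015, Def. 4.13] [cite: MazurTateTeitelbaum1986Invent, §I.8 (8.6)] -/
theorem constantCoeff_flat_eq_zero_iff (hf : IsNewformOf W f) (hgood : W.HasGoodReductionAtPrime 2)
    (ha : Even (W.frobeniusTrace 2)) (h : IsSprungPair f 2 (W.frobeniusTrace 2) Lsharp Lflat) :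
    PowerSeries.constantCoeff Lflat = 0 ↔ W.entireLFunction 1 = 0 := by
  rw [← ratPlusSymbol_zero_eq_zero_iff hf]
  exact padicInt_eq_zero_iff_of_coe_eq (by exact_mod_cast flatPrefactorTwo_ne_zero_of_even ha)
    (constantCoeff_flat_eq_two hf hgood h)

/-- **`L♯(0) = 0 ⟺ L(E,1) = 0`** at a good prime `2` with `a₂ ≠ 1` (every supersingular `2`; the excluded `a₂ = 1` is the anomalous
ordinary case, where `A(1) = 0` and `L♯(0) = 0` identically). [cite: Sprung2015, Def. 4.13] [cite: MazurTateTeitelbaum1986Invent, §I.8 (8.6)] -/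
theorem constantCoeff_sharp_eq_zero_iff (hf : IsNewformOf W f) (hgood : W.HasGoodReductionAtPrime 2)
    (ha : W.frobeniusTrace 2 ≠ 1) (h : IsSprungPair f 2 (W.frobeniusTrace 2) Lsharp Lflat) :
    PowerSeries.constantCoeff Lsharp = 0 ↔ W.entireLFunction 1 = 0 := by
  rw [← ratPlusSymbol_zero_eq_zero_iff hf]
  have hA : sharpPrefactorTwo (W.frobeniusTrace 2) ≠ 0 := fun h0 ↦ ha (sharpPrefactorTwo_eq_zero_iff.mp h0)
  exact padicInt_eq_zero_iff_of_coe_eq (by exact_mod_cast hA) (constantCoeff_sharp_eq_two hf hgood h)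

/-- **Positive analytic rank ⟹ `L♯(0) = L♭(0) = 0`** at a good prime `2` (any `a₂`): `L(E,1) = 0` ⟹ `[0]⁺_f = 0` ⟹ both constant
terms `A(a₂)[0]⁺_f`, `B(a₂)[0]⁺_f` vanish.  In the crux's rank-one setting this is what makes `c₁♯ = [T¹]L♯`, `c₁♭ = [T¹]L♭` the
leading candidates of 55A. [cite: Sprung2015, Def. 4.13] [cite: MazurTateTeitelbaum1986Invent, §I.8 (8.6)] -/
theorem constantCoeff_eq_zero_of_analyticRank_ne_zero (hf : IsNewformOf W f) (hgood : W.HasGoodReductionAtPrime 2)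
    (hr : W.analyticRank ≠ 0) (h : IsSprungPair f 2 (W.frobeniusTrace 2) Lsharp Lflat) :
    PowerSeries.constantCoeff Lsharp = 0 ∧ PowerSeries.constantCoeff Lflat = 0 := by
  have hL : W.entireLFunction 1 = 0 := apply_eq_zero_of_analyticOrderNatAt_ne_zero hr
  have h0 : ratPlusSymbol f 0 = 0 := (ratPlusSymbol_zero_eq_zero_iff hf).mpr hL
  have hS := constantCoeff_sharp_eq_two hf hgood h
  have hF := constantCoeff_flat_eq_two hf hgood h
  rw [h0, mul_zero, Rat.cast_zero] at hS hF
  exact ⟨PadicInt.ext (by simpa using hS), PadicInt.ext (by simpa using hF)⟩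

/-- **Analytic rank `0` ∧ `a₂` even ⟹ `L♯(0) ≠ 0 ∧ L♭(0) ≠ 0`** at a good prime `2`: modularity (`IsNewformOf`) makes `L(E,s)`
entire, so `r_an = 0 ⟺ L(E,1) ≠ 0` (`analyticRank_eq_zero_iff_holds`), and `A(a₂), B(a₂) ≠ 0`.
[cite: Sprung2015, Def. 4.13] [cite: BirchSwinnertonDyer1965] -/
theorem constantCoeff_ne_zero_of_analyticRank_eq_zero (hf : IsNewformOf W f) (hgood : W.HasGoodReductionAtPrime 2)
    (ha : Even (W.frobeniusTrace 2)) (hr : W.analyticRank = 0) (h : IsSprungPair f 2 (W.frobeniusTrace 2) Lsharp Lflat) :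
    PowerSeries.constantCoeff Lsharp ≠ 0 ∧ PowerSeries.constantCoeff Lflat ≠ 0 := by
  have hE : W.HasEntireLFunction :=
    WeierstrassCurve.hasEntireLFunction_of_cuspCoeff_eq (strictWidthInfty_Gamma0 _) W f hf.2
  have hL : W.entireLFunction 1 ≠ 0 := (W.analyticRank_eq_zero_iff_holds hE).mp hr
  have ha1 : W.frobeniusTrace 2 ≠ 1 := by
    rintro h1
    rw [h1] at ha
    exact Int.not_even_one ha
  exact ⟨fun h0 ↦ hL ((constantCoeff_sharp_eq_zero_iff hf hgood ha1 h).mp h0),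
    fun h0 ↦ hL ((constantCoeff_flat_eq_zero_iff hf hgood ha h).mp h0)⟩

end Main

end Summit.BirchSwinnertonDyer.BirchSwinnertonDyer.Theorems.PerrinRiouElementAtTwo

end
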